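import Mathlib.RingTheory.LocalRing.ResidueField.Basic
import Literature.AlgebraicGeometry.Resolution.Blowups
import Literature.AlgebraicGeometry.Resolution.BlowupsRelativeCartier
import HarnessLib

/-!
# Blowing up a section commutes with passage to the special fibre when the exceptional divisor is flat over the base

Helper sub-goal `isBlowup_specialFibre_of_flat_exceptional` of the stub `stub_resolveOnePoint_dimOne`
of the line `strata-split` for the crux `EquisingularLift` (stmt-ResolutionOfSingularities-15660).

Let `O` be a discrete valuation ring with residue field `κ`, `r : U → Spec O` and `s : Spec O → U`
morphisms, and `τ : U' → U` a blow-up (universal property, `IsBlowup` of `Blowups.lean`,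
Görtz–Wedhorn Def. 13.90) of `U` along the ideal sheaf `ker s`. If the exceptional divisor
`E = V(ker s · 𝒪_{U'})` is FLAT over `Spec O` (a relative effective Cartier divisor), then the base
change of `τ` to the special fibre `U_κ = U ×_{Spec O} Spec κ` (Mathlib's chosen fibre product along
`Spec (residue O) : Spec κ → Spec O`) is a blow-up of `U_κ` along `ker s · 𝒪_{U_κ}`.

This is the tree theorem `IsBlowup.pullback_snd_of_flat_exceptional`
(`BlowupsRelativeCartier.lean`: Stacks 056P (1) with 0805, EGA IV₄ (21.15.9)) for the `O`-algebra
`κ = IsLocalRing.ResidueField O`, whose structure map `algebraMap O κ` is `IsLocalRing.residue O`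
definitionally (`IsLocalRing.ResidueField.algebraMap_eq`), so that
`specOfAlgebra O κ = Spec.map (ofHom (residue O))` by `rfl`.

References: The Stacks Project, Tags 056P, 0805; A. Grothendieck, EGA IV₄, Publ. Math. IHÉS 32
(1967), (21.15.9); U. Görtz, T. Wedhorn, *Algebraic Geometry I*, 2nd ed. (2020), Def. 13.90.
-/

set_option linter.dupNamespace false -- mandated namespace of this single-conjunct summit
set_option linter.overlappingInstances false -- the registered signature carries both [IsDomain O] and [IsDiscreteValuationRing O] (Mathlib's class takes the former as a parameter)

namespace Summit.ResolutionOfSingularities.ResolutionOfSingularities.Cruxes.EquisingularLift.StrataSplit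

open CategoryTheory CategoryTheory.Limits AlgebraicGeometry
open Literature.AlgebraicGeometry.Resolution

/-- **Blowing up a section commutes with passage to the special fibre when the exceptional divisor
is flat over the DVR.** For a discrete valuation ring `O`, morphisms `r : U → Spec O`,
`s : Spec O → U`, and a blow-up `τ : U' → U` along `ker s` whose exceptional divisor
`V(ker s · 𝒪_{U'})` is flat over `Spec O` (via `τ ≫ r`), the base change
`pullback.snd τ (pullback.fst r (Spec κ → Spec O)) : U' ×_U U_κ → U_κ` to the special fibre
`U_κ = U ×_{Spec O} Spec κ`, `κ` the residue field, is a blow-up of `U_κ` along `ker s · 𝒪_{U_κ}`.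
Special case `E := ResidueField O` of `IsBlowup.pullback_snd_of_flat_exceptional`.
[cite: StacksProject, Tag 056P (1) with Tag 0805] -/
theorem isBlowup_specialFibre_of_flat_exceptional : ∀ (O : Type) [CommRing O] [IsDomain O] [IsDiscreteValuationRing O] (U U' : AlgebraicGeometry.Scheme.{0}) (r : U ⟶ AlgebraicGeometry.Spec (.of O)) (s : AlgebraicGeometry.Spec (.of O) ⟶ U) (τ : U' ⟶ U), Literature.AlgebraicGeometry.Resolution.IsBlowup τ s.ker → AlgebraicGeometry.Flat (CategoryTheory.CategoryStruct.comp (s.ker.comap τ).subschemeι (CategoryTheory.CategoryStruct.comp τ r)) → Literature.AlgebraicGeometry.Resolution.IsBlowup (CategoryTheory.Limits.pullback.snd τ (CategoryTheory.Limits.pullback.fst r (AlgebraicGeometry.Spec.map (CommRingCat.ofHom (IsLocalRing.residue O))))) (s.ker.comap (CategoryTheory.Limits.pullback.fst r (AlgebraicGeometry.Spec.map (CommRingCat.ofHom (IsLocalRing.residue O))))) := by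
  intro O _ _ _ U U' r s τ hτ hflat
  haveI := hflat
  exact hτ.pullback_snd_of_flat_exceptional (IsLocalRing.ResidueField O) r

end Summit.ResolutionOfSingularities.ResolutionOfSingularities.Cruxes.EquisingularLift.StrataSplit
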